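import Literature.NumberTheory.Sieve.MatomakiRadziwillLemma3Complex
import Literature.NumberTheory.LFunctions.GranvilleSoundararajan2003Proofs
import HarnessLib

/-!
# Matomäki–Radziwiłł 2016, Lemma 3 for complex `f`: the printed shape, given the distance floor

Topic `Literature/NumberTheory/Sieve`.  Everything in this file is PROVED; no definitions, no named facts.

Continuation of `MatomakiRadziwillLemma3Complex.lean` (Lemma 3 of K. Matomäki, M. Radziwiłł, Ann. of Math. 183
(2016), §2, re-run for `f : ArithmeticFunction ℂ` with the Lemma-2 input abstracted to a floor `M₀` on the Halász
window `T_H`): the two parts are assembled into the printed right-hand side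
`C (log Q/((log X)^{1/16} log P) + log X · exp(−(log X/(3 log Q)) log(log X/log Q)))` — the shape of the
hypothesis `h3` of the `𝒰`-part of Proposition 1 and of Lemma A.4 of Matomäki–Radziwiłł–Tao 2015 — under the
quantitative requirements `e^{-(39/40) M₀} ≤ K_M (log X)^{-1/16}` and `(log X)^{1/16} ≤ 4 T_H` (the final constant is
`C (1 + K_M)`).  The sharp Halász theorem being proved in the tree (`GranvilleSoundararajan2003_theorem1_holds`), no
named input remains here; the consumer supplies `(M₀, T_H, K_M)` from the Granville–Soundararajan device relative to
the minimiser (`MatomakiRadziwillTaoSiftedInputs.lean`) and a Vinogradov–Korobov prime tail.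

* `size_facts` — `log X ≥ 4¹⁶ ⇒ Y_* ≥ 4`, `log log(2X)/log Y_* ≤ 11 (log X)^{-1/16}`;
* `lemma3_complex_of_floor` — the bound.

## References
* K. Matomäki, M. Radziwiłł, Ann. of Math. (2) 183 (2016) (arXiv:1501.04585), §2, Lemma 3.
  [cite: MatomakiRadziwillAnnals2016, Lemma 3]
* K. Matomäki, M. Radziwiłł, T. Tao, Algebra & Number Theory 9 (2015), Appendix A, Lemma A.4.
  [cite: MatomakiRadziwillTao2015, Appendix A, Lemma A.4]
-/

noncomputable section

open Finset Real Complex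
open Literature.NumberTheory.LFunctions.GranvilleSoundararajan
open Literature.NumberTheory.Sieve.MatomakiRadziwillL4A

namespace Literature.NumberTheory.Sieve

namespace MatomakiRadziwillL3C

open MatomakiRadziwillL13 (sPart)
open MatomakiRadziwillL3 (primesPQ primesPQ_prime Ystar SigAll halasz_of_GS T1 T2 inv_rpow_le_T1 T2_pos exp_SigAll_le)

/-! ### The complex Lemma 3 in the printed shape, given the distance floor -/

/-- `log log (2X) / log Y_* ≤ 11 (log X)^{-1/16}` and the other size facts for `log X ≥ 4¹⁶`. [folklore] -/
theorem size_facts {X : ℝ} (hX : Real.exp ((4 : ℝ) ^ 16) ≤ X) :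
    (4 : ℝ) ^ 16 ≤ Real.log X ∧ 4 ≤ Ystar X ∧ 1 ≤ X ∧
      Real.log (Real.log (2 * X)) / Real.log (Ystar X) ≤ 11 / Real.log X ^ (1 / 16 : ℝ) := by
  have h416 : (4 : ℝ) ^ 16 = 4294967296 := by norm_num
  have hX0 : 0 < X := (Real.exp_pos _).trans_le hX
  have hℓ : (4 : ℝ) ^ 16 ≤ Real.log X := by
    have := Real.log_le_log (Real.exp_pos _) hX; rwa [Real.log_exp] at this
  set ℓ := Real.log X with hℓdef
  have hℓ0 : 0 < ℓ := by rw [h416] at hℓ; linarith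
  have hX1 : 1 ≤ X := by
    have := Real.add_one_le_exp ((4 : ℝ) ^ 16); rw [h416] at this hX; linarith
  have hXexp : X = Real.exp ℓ := by rw [hℓdef, Real.exp_log hX0]
  -- `Y_* = X^{1/4}/2 = e^{ℓ/4}/2`, `log Y_* = ℓ/4 - log 2 ≥ ℓ/5`
  have hYdef : Ystar X = X ^ (1 / 4 : ℝ) / 2 := rfl
  have hXq : X ^ (1 / 4 : ℝ) = Real.exp (ℓ / 4) := by
    rw [Real.rpow_def_of_pos hX0, hℓdef]; ring_nf
  have hlog2 : Real.log 2 < 1 := by have := Real.log_two_lt_d9; linarith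
  have hY4 : 4 ≤ Ystar X := by
    rw [hYdef, hXq]
    have : (8 : ℝ) ≤ Real.exp (ℓ / 4) := by
      have h1 : ℓ / 4 ≥ 8 := by rw [h416] at hℓ; linarith
      have := Real.add_one_le_exp (ℓ / 4); linarith
    linarith
  have hlogY : ℓ / 5 ≤ Real.log (Ystar X) := by
    rw [hYdef, hXq, Real.log_div (Real.exp_pos _).ne' two_ne_zero, Real.log_exp]
    rw [h416] at hℓ; linarith
  have hlogY0 : 0 < Real.log (Ystar X) := by rw [h416] at hℓ; linarith
  -- `log log (2X) ≤ 2 log ℓ ≤ 2 · 16 ℓ^{1/16}`... we use `log u ≤ u^{ε}/ε` with `ε = 1/16` for `u = log(2X) ≤ 2ℓ`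
  have hlog2X : Real.log (2 * X) ≤ 2 * ℓ := by
    rw [Real.log_mul two_ne_zero hX0.ne']; rw [h416] at hℓ; linarith
  have hlog2X0 : 1 < Real.log (2 * X) := by
    rw [Real.log_mul two_ne_zero hX0.ne']
    have : 0 < Real.log 2 := Real.log_pos one_lt_two
    rw [h416] at hℓ; linarith
  have hll : Real.log (Real.log (2 * X)) ≤ (2 * ℓ) ^ (1 / 16 : ℝ) / (1 / 16) := by
    calc Real.log (Real.log (2 * X)) ≤ Real.log (2 * ℓ) := Real.log_le_log (by linarith) hlog2X
      _ ≤ (2 * ℓ) ^ (1 / 16 : ℝ) / (1 / 16) := Real.log_le_rpow_div (by linarith) (by norm_num)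
  have h2ℓ : (2 * ℓ) ^ (1 / 16 : ℝ) ≤ 2 * ℓ ^ (1 / 16 : ℝ) := by
    rw [Real.mul_rpow (by norm_num) hℓ0.le]
    have : (2 : ℝ) ^ (1 / 16 : ℝ) ≤ 2 := by
      calc (2 : ℝ) ^ (1 / 16 : ℝ) ≤ (2 : ℝ) ^ (1 : ℝ) := Real.rpow_le_rpow_of_exponent_le one_le_two (by norm_num)
        _ = 2 := Real.rpow_one 2
    exact mul_le_mul_of_nonneg_right this (Real.rpow_nonneg hℓ0.le _)
  have hllb : Real.log (Real.log (2 * X)) ≤ 32 * ℓ ^ (1 / 16 : ℝ) := by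
    have : (2 * ℓ) ^ (1 / 16 : ℝ) / (1 / 16) = 16 * (2 * ℓ) ^ (1 / 16 : ℝ) := by ring
    rw [this] at hll; linarith
  refine ⟨hℓ, hY4, hX1, ?_⟩
  -- `32 ℓ^{1/16} / (ℓ/5) = 160 ℓ^{1/16}/ℓ = 160 / ℓ^{15/16} ≤ 11/ℓ^{1/16}` since `ℓ^{14/16} ≥ 160/11`
  have hr : Real.log (Real.log (2 * X)) / Real.log (Ystar X) ≤ 32 * ℓ ^ (1 / 16 : ℝ) / (ℓ / 5) := by
    have h0 : 0 ≤ Real.log (Real.log (2 * X)) := Real.log_nonneg hlog2X0.le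
    calc Real.log (Real.log (2 * X)) / Real.log (Ystar X) ≤ Real.log (Real.log (2 * X)) / (ℓ / 5) :=
          div_le_div_of_nonneg_left h0 (by positivity) hlogY
      _ ≤ 32 * ℓ ^ (1 / 16 : ℝ) / (ℓ / 5) := div_le_div_of_nonneg_right hllb (by positivity)
  refine hr.trans ?_
  have hpow : ℓ ^ (1 / 16 : ℝ) * ℓ ^ (1 / 16 : ℝ) * ℓ ^ (14 / 16 : ℝ) = ℓ := by
    rw [← Real.rpow_add hℓ0, ← Real.rpow_add hℓ0]; norm_num
  have h14 : (16 : ℝ) ≤ ℓ ^ (14 / 16 : ℝ) := by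
    have e16 : (16 : ℝ) = ((16 : ℝ) ^ (16 / 14 : ℝ)) ^ (14 / 16 : ℝ) := by
      rw [← Real.rpow_mul (by norm_num)]; norm_num
    have hle : (16 : ℝ) ^ (16 / 14 : ℝ) ≤ ℓ := by
      have h1 : (16 : ℝ) ^ (16 / 14 : ℝ) ≤ (16 : ℝ) ^ (2 : ℝ) :=
        Real.rpow_le_rpow_of_exponent_le (by norm_num) (by norm_num)
      have h2 : (16 : ℝ) ^ (2 : ℝ) = 256 := by norm_num
      rw [h416] at hℓ; linarith
    have := Real.rpow_le_rpow (by positivity) hle (by norm_num : (0:ℝ) ≤ 14 / 16)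
    rwa [← e16] at this
  have hp0 : 0 < ℓ ^ (1 / 16 : ℝ) := Real.rpow_pos_of_pos hℓ0 _
  rw [div_le_div_iff₀ (by positivity) hp0]
  nlinarith [mul_pos hp0 hp0]

set_option maxHeartbeats 400000 in
/-- **Matomäki–Radziwiłł's Lemma 3 for complex `f`, in the printed shape, given the distance floor** (the structure of
Lemma A.4 of Matomäki–Radziwiłł–Tao 2015).  With `C_H` the constant of `halasz_of_GS` (the sharp Halász theorem is
proved in the tree) and `C_M` Mertens' constant of `RankinComposed.exists_abs_sum_inv_primes_Icc_sub_le`, there is `C`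
such that: for every multiplicative `f : ArithmeticFunction ℂ` with `|f| ≤ 1`, `2 ≤ P ≤ Q ≤ X` with `log X ≥ 4¹⁶`, every
`t`, every Halász window `T_H` with `1 ≤ T_H`, `(log X)^{1/16} ≤ 4 T_H`, and every floor `M₀` of the distances of the
sifted twist on the fibres (`hM₀`) with `e^{-(39/40) M₀} ≤ K_M (log X)^{-1/16}` (`K_M ≥ 0`),
`|R(1+it)| ≤ C (1 + K_M) (log Q/((log X)^{1/16} log P) + log X · exp(−(log X/(3 log Q)) log(log X/log Q)))`.
[cite: MatomakiRadziwillAnnals2016, Lemma 3] [cite: MatomakiRadziwillTao2015, Appendix A, Lemma A.4] -/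
theorem lemma3_complex_of_floor :
    ∃ C : ℝ, 0 ≤ C ∧ ∀ (f : ArithmeticFunction ℂ), f.IsMultiplicative → (∀ n, ‖f n‖ ≤ 1) →
      ∀ X P Q t TH M₀ K_M : ℝ, 2 ≤ P → P ≤ Q → Q ≤ X → Real.exp ((4 : ℝ) ^ 16) ≤ X →
        1 ≤ TH → Real.log X ^ (1 / 16 : ℝ) ≤ 4 * TH → 0 ≤ K_M →
        Real.exp (-(39 / 40) * M₀) ≤ K_M / Real.log X ^ (1 / 16 : ℝ) →
        (∀ Y : ℝ, Ystar X ≤ Y → ∀ y : ℝ, |y| ≤ 2 * TH → M₀ ≤ Msum (siftedTwistC f (primesPQ P Q) t) Y y) →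
        ‖∑ n ∈ Finset.Icc ⌈X⌉₊ ⌊2 * X⌋₊,
            f n * (n : ℂ) ^ (-(1 + (t : ℂ) * I)) / ((primeDivisorsIn P Q n : ℂ) + 1)‖ ≤
          C * (1 + K_M) * (Real.log Q / (Real.log X ^ (1 / 16 : ℝ) * Real.log P)
            + Real.log X * Real.exp (-(Real.log X / (3 * Real.log Q)) * Real.log (Real.log X / Real.log Q))) := by
  obtain ⟨C_H, hC_H, hH⟩ := halasz_of_GS
    Literature.NumberTheory.LFunctions.GranvilleSoundararajan.GranvilleSoundararajan2003_theorem1_holds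
  obtain ⟨C_M, hCM⟩ := RankinComposed.exists_abs_sum_inv_primes_Icc_sub_le
  have hCM0 : 0 ≤ C_M := le_trans (abs_nonneg _) (hCM 2 2 le_rfl le_rfl)
  set K₂ : ℝ := 2 + 6 * Real.exp (C_M + 3 + RankinComposed.C₀ + 24 * Real.exp 288) +
    (400 / 3) * Real.exp (Real.exp 400 + RankinComposed.C₀) + 450 * Real.exp RankinComposed.C₀ with hK₂
  set K₁ : ℝ := 6 * C_H * Real.exp (RankinComposed.C₀ + C_M) with hK₁
  have hK₂0 : 0 ≤ K₂ := by positivity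
  have hK₁0 : 0 ≤ K₁ := by positivity
  refine ⟨15 * K₁ + K₂, by positivity, ?_⟩
  intro f hf hf1 X P Q t TH M₀ K_M hP hPQ hQX hX hTH hTH4 hKM hM hM₀
  obtain ⟨hℓ, hY4, hX1, hratio⟩ := size_facts hX
  have h416 : (4 : ℝ) ^ 16 = 4294967296 := by norm_num
  have hℓ1 : 1 ≤ Real.log X := by rw [h416] at hℓ; linarith
  have hlogX : 0 < Real.log X := by linarith
  have hT1 := inv_rpow_le_T1 hP hPQ hlogX
  have hT1pos : 0 < T1 X P Q := lt_of_lt_of_le (by positivity) hT1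
  have hT2 : 0 ≤ T2 X Q := by unfold T2; positivity
  show ‖∑ n ∈ Finset.Icc ⌈X⌉₊ ⌊2 * X⌋₊, summandRC f P Q t n‖ ≤ (15 * K₁ + K₂) * (1 + K_M) * (T1 X P Q + T2 X Q)
  -- split
  have hsplit : ∑ n ∈ Finset.Icc ⌈X⌉₊ ⌊2 * X⌋₊, summandRC f P Q t n =
      ∑ n ∈ (Finset.Icc ⌈X⌉₊ ⌊2 * X⌋₊).filter (fun n => sPart (primesPQ P Q) n ≤ ⌊X ^ (3 / 4 : ℝ)⌋₊), summandRC f P Q t n +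
      ∑ n ∈ (Finset.Icc ⌈X⌉₊ ⌊2 * X⌋₊).filter (fun n => ⌊X ^ (3 / 4 : ℝ)⌋₊ < sPart (primesPQ P Q) n), summandRC f P Q t n := by
    classical
    rw [← Finset.sum_filter_add_sum_filter_not _ (fun n => sPart (primesPQ P Q) n ≤ ⌊X ^ (3 / 4 : ℝ)⌋₊)]
    congr 1
    refine Finset.sum_congr (Finset.filter_congr fun n _ => by simp [not_le]) fun _ _ => rfl
  rw [hsplit]
  refine (norm_add_le _ _).trans ?_
  have h1 := first_part_le hC_H hH hf hf1 hX1 hY4 hTH hM₀ (P := P) (Q := Q)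
  have h2 := second_part_numeric hCM hf1 hP hPQ hQX hℓ1 (t := t)
  rw [← hK₂] at h2
  -- the first part in terms of `T₁`
  have hSig := exp_SigAll_le hCM hP hPQ
  have hlogP : 0 < Real.log P := Real.log_pos (by linarith)
  have hlogQ : 0 < Real.log Q := Real.log_pos (by linarith)
  have hQP : 0 ≤ Real.log Q / Real.log P := by positivity
  have hL16 : 0 < Real.log X ^ (1 / 16 : ℝ) := Real.rpow_pos_of_pos hlogX _
  have hbr : Real.exp (-(39 / 40) * M₀) + (1 / TH + Real.log (Real.log (2 * X)) / Real.log (Ystar X)) ≤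
      (K_M + 15) / Real.log X ^ (1 / 16 : ℝ) := by
    have h1T : 1 / TH ≤ 4 / Real.log X ^ (1 / 16 : ℝ) := by
      rw [div_le_div_iff₀ (by linarith) hL16]; linarith
    rw [add_div]
    have : 4 / Real.log X ^ (1 / 16 : ℝ) + 11 / Real.log X ^ (1 / 16 : ℝ) = 15 / Real.log X ^ (1 / 16 : ℝ) := by ring
    linarith
  have hfirst : Real.exp (SigAll (primesPQ P Q) + RankinComposed.C₀) *
      (6 * (C_H * Real.exp (-(39 / 40) * M₀) + C_H * (1 / TH + Real.log (Real.log (2 * X)) / Real.log (Ystar X)))) ≤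
      K₁ * (K_M + 15) * T1 X P Q := by
    rw [Real.exp_add]
    have e1 : 6 * (C_H * Real.exp (-(39 / 40) * M₀) + C_H * (1 / TH + Real.log (Real.log (2 * X)) / Real.log (Ystar X))) =
        6 * C_H * (Real.exp (-(39 / 40) * M₀) + (1 / TH + Real.log (Real.log (2 * X)) / Real.log (Ystar X))) := by ring
    rw [e1]
    have hbr0 : 0 ≤ Real.exp (-(39 / 40) * M₀) + (1 / TH + Real.log (Real.log (2 * X)) / Real.log (Ystar X)) := by
      have : 0 ≤ Real.log (Real.log (2 * X)) / Real.log (Ystar X) := by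
        refine div_nonneg (Real.log_nonneg ?_) (Real.log_nonneg (by linarith))
        have hX8 : (8 : ℝ) ≤ X := by
          have : Ystar X = X ^ (1 / 4 : ℝ) / 2 := rfl
          have h14 : X ^ (1 / 4 : ℝ) ≤ X := by
            calc X ^ (1 / 4 : ℝ) ≤ X ^ (1 : ℝ) := Real.rpow_le_rpow_of_exponent_le hX1 (by norm_num)
              _ = X := Real.rpow_one X
          rw [this] at hY4; linarith
        rw [← Real.log_exp 1]; refine Real.log_le_log (Real.exp_pos 1) ?_
        have := Real.exp_one_lt_d9; norm_num at this; linarith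
      positivity
    calc Real.exp (SigAll (primesPQ P Q)) * Real.exp RankinComposed.C₀ *
          (6 * C_H * (Real.exp (-(39 / 40) * M₀) + (1 / TH + Real.log (Real.log (2 * X)) / Real.log (Ystar X))))
        ≤ (Real.exp C_M * (Real.log Q / Real.log P)) * Real.exp RankinComposed.C₀ *
          (6 * C_H * ((K_M + 15) / Real.log X ^ (1 / 16 : ℝ))) := by
          refine mul_le_mul (mul_le_mul_of_nonneg_right hSig (Real.exp_pos _).le)
            (mul_le_mul_of_nonneg_left hbr (by positivity)) (by positivity) (by positivity)
      _ = K₁ * (K_M + 15) * T1 X P Q := by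
          rw [hK₁, Real.exp_add]; unfold T1; field_simp
  have hfirst' := h1.trans hfirst
  -- combine
  have hK115 : K₁ * (K_M + 15) * T1 X P Q + K₂ * (T1 X P Q + T2 X Q) ≤
      (15 * K₁ + K₂) * (1 + K_M) * (T1 X P Q + T2 X Q) := by
    have a1 : K₁ * (K_M + 15) ≤ (15 * K₁) * (1 + K_M) := by nlinarith
    have a2 : K₂ ≤ K₂ * (1 + K_M) := le_mul_of_one_le_right hK₂0 (by linarith)
    have hTT : 0 ≤ T1 X P Q + T2 X Q := by linarith
    nlinarith [mul_nonneg (mul_nonneg hK₁0 hKM) hT2, mul_nonneg hK₁0 hT2, mul_nonneg hK₂0 hTT,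
      mul_nonneg (mul_nonneg hK₂0 hKM) hTT, mul_le_mul_of_nonneg_right a1 hT1pos.le]
  linarith [hfirst', h2]

end MatomakiRadziwillL3C

end Literature.NumberTheory.Sieve
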